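import Literature.Analysis.FunctionSpaces.TorusLatticeCells
import Literature.Analysis.FunctionSpaces.TorusTrigPoly
import Literature.Analysis.FunctionSpaces.TorusCalculusProofs
import Literature.Analysis.FunctionSpaces.TorusSobolevNorm
import HarnessLib

/-!
# The `Ḣ⁻¹(T^d)` bound for cellwise mean-zero functions

Trunk: Sobolev (`Literature/Analysis/FunctionSpaces`). The mixing estimate behind the
(quasi-)self-similar constructions of Alberti–Crippa–Mazzucato: a scalar on the torus whose
averages vanish on every square of a tiling of mesh `m⁻¹` has functional mixing scale
`‖·‖_{Ḣ⁻¹} ≲ m⁻¹ ‖·‖_{L²}` (Bruè–De Lellis 2023, Thm. 4.1 (b): `‖ρ_n(·,t)‖_{Ḣ⁻¹} ≤ C 5⁻ⁿ` for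
the scalar patched from `4·25ⁿ` mean-zero unit-`L²` blocks on the squares of side `(2·5ⁿ)⁻¹`;
Alberti–Crippa–Mazzucato 2019, §3.3 and §6.4, where the exactly self-similar case is the
scaling identity `‖ρ₀(λ⁻ⁿ·)‖_{Ḣ⁻¹(T²)} = λⁿ ‖ρ₀‖_{Ḣ⁻¹(T²)}`). Neither source prints a proof for
the patched (quasi-self-similar) case; the theorem below is the standard duality argument.

* `Torus.eHomSobolevSeminorm_neg_one_le_of_cellwise`: if `f : T^d → ℝ` is continuous and
  `∫_Q f ∘ proj = 0` for every cell `Q = ∏ᵢ [κᵢ/m, (κᵢ+1)/m)` of `[0,1)^d`, then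
  `‖f‖_{Ḣ⁻¹(T^d)} ≤ 2π (√d/m) 2^{d/2} ‖f‖_{L²(T^d)}` for the spectral seminorm
  `Torus.eHomSobolevSeminorm (-1)` (characters `e^{2πik·x}`, weight `|k|⁻²`) of `f` viewed in `ℂ`.

## Proof (duality with `Ḣ¹` and Poincaré, cell by cell)

For a finite set `T` of frequencies put `c_k := |k|⁻² 𝓕f(k)` (`= 0` at `k = 0`),
`φ := Σ_{k ∈ T} c_k e_k` (`Torus.trigPoly`) and `S := Σ_{k ∈ T} |k|⁻² |𝓕f(k)|²`.
Orthogonality gives `∫ conj(φ) f = S` (`Torus.integral_conj_trigPoly_testCoeff_mul`) and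
`Σⱼ ‖∂ⱼφ‖²_{L²} = 4π² S` (`Torus.sum_integral_norm_sq_partialDeriv_trigPoly`). Writing the
integral over `[0,1)^d`, splitting into cells and using the vanishing cell averages,
`∫_Q conj(φ) f = ∫_Q conj(φ - ⨍_Q φ) f`, so by Cauchy–Schwarz (twice) and the Poincaré
inequality on each cell (`Torus.eLpNorm_sub_setAverage_latticeCell_le`),
`S ≤ (√d/m) 2^{d/2} ‖Dφ‖_{L²([0,1)^d)} ‖f‖_{L²} ≤ (√d/m) 2^{d/2} · 2π S^{1/2} ‖f‖_{L²}`
(`‖Dφ(y)‖ ≤ (Σⱼ ‖∂ⱼφ‖²)^{1/2}`, `Torus.norm_fderiv_le_sqrt_sum_partialDeriv`), i.e.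
`S ≤ (2π (√d/m) 2^{d/2} ‖f‖_{L²})²`; the supremum over `T` is `‖f‖²_{Ḣ⁻¹}`.

## References

* E. Bruè, C. De Lellis, *Anomalous dissipation for the forced 3D Navier–Stokes equations*,
  Comm. Math. Phys. 400 (2023), Thm. 4.1 (b).
* G. Alberti, G. Crippa, A. L. Mazzucato, *Exponential self-similar mixing by incompressible
  flows*, J. Amer. Math. Soc. 32 (2019), 445–490, §2.2 (`Ḣ⁻¹` on `T²`), §3.3, §6.4.
* L. Grafakos, *Classical Fourier Analysis*, 3rd ed. (2014), Prop. 3.2.7 (Parseval).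
-/

noncomputable section

open MeasureTheory Set Filter UnitAddTorus Finset
open scoped ENNReal NNReal Topology

namespace Literature.Analysis.FunctionSpaces

namespace Torus

variable {d : Type*} [Fintype d]

/-! ## The `Ḣ⁻¹` bound for cellwise mean-zero functions -/

section HNegOne

variable [DecidableEq d]

/-- The operator norm of the derivative of a `C¹` function on the torus is controlled by the
Euclidean norm of the vector of partial derivatives: `‖D f(x)‖ ≤ (Σⱼ ‖∂ⱼ f(x)‖²)^{1/2}`
(`Df(x) w = Σⱼ wⱼ ∂ⱼf(x)` and Cauchy–Schwarz). [folklore] -/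
theorem norm_fderiv_le_sqrt_sum_partialDeriv {V : Type*} [NormedAddCommGroup V] [NormedSpace ℝ V]
    {f : UnitAddTorus d → V} (hf : IsContDiff 1 f) (x : UnitAddTorus d) :
    ‖Torus.fderiv f x‖ ≤ Real.sqrt (∑ j, ‖partialDeriv j f x‖ ^ 2) := by
  refine ContinuousLinearMap.opNorm_le_bound _ (Real.sqrt_nonneg _) fun w => ?_
  rw [fderiv_apply_eq_sum_partialDeriv hf x w]
  calc ‖∑ j, w j • partialDeriv j f x‖ ≤ ∑ j, ‖w j • partialDeriv j f x‖ := norm_sum_le _ _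
    _ = ∑ j, |w j| * ‖partialDeriv j f x‖ := by simp [norm_smul]
    _ ≤ Real.sqrt (∑ j, |w j| ^ 2) * Real.sqrt (∑ j, ‖partialDeriv j f x‖ ^ 2) := by
        rw [← Real.sqrt_mul (Finset.sum_nonneg fun j _ => sq_nonneg _)]
        refine Real.le_sqrt_of_sq_le ?_
        exact Finset.sum_mul_sq_le_sq_mul_sq _ _ _
    _ = Real.sqrt (∑ j, ‖partialDeriv j f x‖ ^ 2) * ‖w‖ := by
        rw [mul_comm, EuclideanSpace.norm_eq]
        simp [Real.norm_eq_abs]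

variable [Nonempty d]

omit [DecidableEq d] [Nonempty d] in
/-- **Pairing identity**: for `φ = Σ_{k ∈ T} c_k e_k` with `c_k = |k|⁻² 𝓕f(k)`,
`∫ conj(φ) f = Σ_{k ∈ T} |k|⁻² |𝓕f(k)|²` (orthogonality of characters). [folklore] -/
theorem integral_conj_trigPoly_testCoeff_mul {f : UnitAddTorus d → ℂ} (hf : Continuous f)
    (T : Finset (d → ℤ)) :
    ∫ x, starRingEnd ℂ (trigPoly T (fun k => (((freqNormSq k)⁻¹ : ℝ) : ℂ) * mFourierCoeff f k) x) * f x =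
      ((∑ k ∈ T, (freqNormSq k)⁻¹ * ‖mFourierCoeff f k‖ ^ 2 : ℝ) : ℂ) := by
  have hpt : ∀ x, starRingEnd ℂ (trigPoly T (fun k => (((freqNormSq k)⁻¹ : ℝ) : ℂ) * mFourierCoeff f k) x) * f x =
      ∑ k ∈ T, starRingEnd ℂ ((((freqNormSq k)⁻¹ : ℝ) : ℂ) * mFourierCoeff f k) * (mFourier (-k) x * f x) := by
    intro x
    simp only [trigPoly_apply, smul_eq_mul, map_sum, map_mul, Finset.sum_mul, mFourier_neg]
    refine Finset.sum_congr rfl fun k _ => ?_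
    ring
  simp_rw [hpt]
  have hco : ∀ k : d → ℤ, ∫ a, mFourier (-k) a * f a = mFourierCoeff f k := fun k => by
    rw [mFourierCoeff_eq_integral_volume]; rfl
  rw [integral_finsetSum T
    (f := fun k x => starRingEnd ℂ ((((freqNormSq k)⁻¹ : ℝ) : ℂ) * mFourierCoeff f k) * (mFourier (-k) x * f x)) fun k _ => by
    exact (continuous_const.mul ((mFourier (-k)).continuous.mul hf)).integrable_unitAddTorus]
  push_cast
  refine Finset.sum_congr rfl fun k _ => ?_
  rw [integral_const_mul, hco, map_mul, map_inv₀, Complex.conj_ofReal, mul_assoc, Complex.conj_mul']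

omit [Nonempty d] in
/-- **Gradient energy of a trigonometric polynomial**: `Σⱼ ∫ ‖∂ⱼ(Σ_k c_k e_k)‖² = 4π² Σ_k |k|² ‖c_k‖²`
(diagonal action of `∂ⱼ` and the finite Parseval identity; Grafakos 2014, Prop. 3.2.7 (3)). [folklore] -/
theorem sum_integral_norm_sq_partialDeriv_trigPoly (T : Finset (d → ℤ)) (c : (d → ℤ) → ℂ) :
    ∑ j, ∫ x, ‖partialDeriv j (trigPoly T c) x‖ ^ 2 =
      4 * Real.pi ^ 2 * ∑ k ∈ T, freqNormSq k * ‖c k‖ ^ 2 := by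
  simp_rw [partialDeriv_trigPoly', integral_norm_sq_trigPoly]
  rw [Finset.sum_comm, Finset.mul_sum]
  refine Finset.sum_congr rfl fun k _ => ?_
  rw [freqNormSq, Finset.sum_mul, Finset.mul_sum]
  refine Finset.sum_congr rfl fun j _ => ?_
  rw [smul_eq_mul, norm_mul]
  simp only [Complex.norm_mul, Complex.norm_real, Real.norm_eq_abs, Complex.norm_I,
    Complex.norm_intCast, abs_of_pos Real.pi_pos, Complex.norm_ofNat, mul_one]
  rw [mul_pow, mul_pow, mul_pow, sq_abs]
  ring

omit [DecidableEq d] [Nonempty d] in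
/-- For `c_k = |k|⁻² 𝓕f(k)`: `|k|² ‖c_k‖² = |k|⁻² ‖𝓕f(k)‖²` (also at `k = 0`, where both vanish). [folklore] -/
theorem freqNormSq_mul_norm_testCoeff_sq (f : UnitAddTorus d → ℂ) (k : d → ℤ) :
    freqNormSq k * ‖(((freqNormSq k)⁻¹ : ℝ) : ℂ) * mFourierCoeff f k‖ ^ 2 =
      (freqNormSq k)⁻¹ * ‖mFourierCoeff f k‖ ^ 2 := by
  rw [norm_mul, Complex.norm_real, Real.norm_eq_abs,
    abs_of_nonneg (inv_nonneg.2 (freqNormSq_nonneg k)), mul_pow]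
  rcases eq_or_ne (freqNormSq k) 0 with h | h
  · simp [h]
  · field_simp

/-- **`Ḣ⁻¹` bound for cellwise mean-zero functions.** Let `f : T^d → ℝ` be continuous and let
`m ≥ 1`. If `∫_Q f ∘ proj = 0` for every lattice cell `Q = ∏ᵢ [κᵢ/m, (κᵢ+1)/m)` of the
fundamental cube (`0 ≤ κᵢ < m`), then
`‖f‖_{Ḣ⁻¹(T^d)} ≤ 2π (√d/m) 2^{d/2} ‖f‖_{L²(T^d)}`, where `‖·‖_{Ḣ⁻¹}` is the spectral seminorm
`Torus.eHomSobolevSeminorm (-1)` (characters `e^{2πik·x}`, weight `|k|⁻²`) of `f` viewed in `ℂ`.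
This is the estimate `‖ρ_n(·,t)‖_{Ḣ⁻¹} ≤ C λ⁻ⁿ` for scalars patched from mean-zero cells of
side `λ⁻ⁿ` (Bruè–De Lellis 2023, Thm. 4.1 (b), stated without proof; Alberti–Crippa–Mazzucato
2019, §3.3, §6.4), proved here by duality: with `φ = Σ_{k ∈ T} |k|⁻² 𝓕f(k) e_k` one has `S := Σ_{k∈T} |k|⁻²|𝓕f(k)|² = ∫ conj(φ) f`
and `‖∇φ‖²_{L²} = 4π² S`, while cell by cell `∫_Q conj(φ) f = ∫_Q conj(φ - ⨍_Q φ) f`, so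
Cauchy–Schwarz and the Poincaré inequality on the cells (`eLpNorm_sub_setAverage_latticeCell_le`)
give `S ≤ (√d/m) 2^{d/2} ‖∇φ‖_{L²} ‖f‖_{L²}`. [cite: BrueDeLellisCMP2023, Thm. 4.1 (b)] -/
theorem eHomSobolevSeminorm_neg_one_le_of_cellwise {f : UnitAddTorus d → ℝ} (hf : Continuous f)
    {m : ℕ} (hm : 0 < m)
    (h0 : ∀ κ : d → Fin m, ∫ y in latticeCell m (fun i => ((κ i : ℕ) : ℤ)), f (proj y) = 0) :
    eHomSobolevSeminorm (-1) (fun x => (f x : ℂ)) ≤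
      ENNReal.ofReal (2 * Real.pi * (Real.sqrt (Fintype.card d) / m)) *
        2 ^ ((Fintype.card d : ℝ) / 2) * (∫⁻ x, ‖f x‖ₑ ^ (2 : ℝ)) ^ (1 / 2 : ℝ) := by
  -- notation
  set F : UnitAddTorus d → ℂ := fun x => (f x : ℂ) with hFdef
  have hF : Continuous F := Complex.continuous_ofReal.comp hf
  set Cd : ℝ≥0∞ := ENNReal.ofReal (Real.sqrt (Fintype.card d) / m) * 2 ^ ((Fintype.card d : ℝ) / 2)
    with hCd
  set N : ℝ≥0∞ := (∫⁻ x, ‖f x‖ₑ ^ (2 : ℝ)) ^ (1 / 2 : ℝ) with hN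
  set K : ℝ≥0∞ := Cd * ENNReal.ofReal (2 * Real.pi) * N with hK
  -- the cells
  set Q : (d → Fin m) → Set (EuclideanSpace ℝ d) := fun κ => latticeCell m (fun i => ((κ i : ℕ) : ℤ))
    with hQ
  set Qo : (d → Fin m) → Set (EuclideanSpace ℝ d) :=
    fun κ => latticeCellInterior m (fun i => ((κ i : ℕ) : ℤ)) with hQo
  have hrestr : ∀ κ, (volume : Measure (EuclideanSpace ℝ d)).restrict (Q κ) = volume.restrict (Qo κ) :=
    fun κ => restrict_latticeCell_eq hm
  -- `Σ_κ ‖f ∘ proj‖²_{L²(Q_κ)} = ‖f‖²_{L²}`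
  have hBsum : ∑ κ, ∫⁻ y in Q κ, ‖f (proj y)‖ₑ ^ (2 : ℝ) = ∫⁻ x, ‖f x‖ₑ ^ (2 : ℝ) := by
    rw [← setLIntegral_unitCube_eq_sum_latticeCell hm (fun y => ‖f (proj y)‖ₑ ^ (2 : ℝ))]
    exact setLIntegral_unitCube_lift (H := fun x => ‖f x‖ₑ ^ (2 : ℝ))
      (hf.measurable.enorm.pow_const _).aemeasurable
  -- the key finite-frequency estimate
  have key : ∀ T : Finset (d → ℤ),
      ENNReal.ofReal (∑ k ∈ T, (freqNormSq k)⁻¹ * ‖mFourierCoeff F k‖ ^ 2) ≤ K ^ 2 := by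
    intro T
    set S : ℝ := ∑ k ∈ T, (freqNormSq k)⁻¹ * ‖mFourierCoeff F k‖ ^ 2 with hSdef
    have hS0 : 0 ≤ S := Finset.sum_nonneg fun k _ =>
      mul_nonneg (inv_nonneg.2 (freqNormSq_nonneg k)) (sq_nonneg _)
    set c : (d → ℤ) → ℂ := fun k => (((freqNormSq k)⁻¹ : ℝ) : ℂ) * mFourierCoeff F k with hc
    set φ : UnitAddTorus d → ℂ := trigPoly T c with hφdef
    have hφ : IsSmooth φ := isSmooth_trigPoly T c
    set u : EuclideanSpace ℝ d → ℂ := lift φ with hudef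
    have hu : ContDiff ℝ 1 u := hφ.isContDiff (n := 1) (by simp)
    have huc : Continuous u := hu.continuous
    -- (i) pairing
    have hpair : ∫ x, starRingEnd ℂ (φ x) * F x = (S : ℂ) :=
integral_conj_trigPoly_testCoeff_mul hF T
    -- (ii) gradient energy
    have henergy : ∑ j, ∫ x, ‖partialDeriv j φ x‖ ^ 2 = 4 * Real.pi ^ 2 * S := by
      rw [hφdef, sum_integral_norm_sq_partialDeriv_trigPoly]
      simp_rw [hc, freqNormSq_mul_norm_testCoeff_sq]
      rw [hSdef]
    -- (iii) cellwise estimate of the pairing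
    set A : (d → Fin m) → ℝ≥0∞ := fun κ =>
      eLpNorm (fun y => u y - ⨍ z in Qo κ, u z) 2 (volume.restrict (Qo κ)) with hA
    set B : (d → Fin m) → ℝ≥0∞ := fun κ => (∫⁻ y in Q κ, ‖f (proj y)‖ₑ ^ (2 : ℝ)) ^ (1 / 2 : ℝ)
      with hB
    set E : (d → Fin m) → ℝ≥0∞ := fun κ => eLpNorm (_root_.fderiv ℝ u) 2 (volume.restrict (Qo κ))
      with hE
    have hcell : ∀ κ, ‖∫ y in Q κ, starRingEnd ℂ (u y) * F (proj y)‖ₑ ≤ A κ * B κ := by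
      intro κ
      set a : ℂ := ⨍ z in Qo κ, u z with ha
      have hsub : Q κ ⊆ unitCube d := latticeCell_subset_unitCube hm κ
      have hi1 : IntegrableOn (fun y => starRingEnd ℂ (u y - a) * F (proj y)) (Q κ) volume :=
        (integrableOn_unitCube_of_continuous
          ((Complex.continuous_conj.comp (huc.sub continuous_const)).mul
            (hF.comp continuous_proj))).mono_set hsub
      have hi2 : IntegrableOn (fun y => starRingEnd ℂ a * F (proj y)) (Q κ) volume :=
        (integrableOn_unitCube_of_continuous
          (continuous_const.mul (hF.comp continuous_proj))).mono_set hsub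
      have hsplit : ∫ y in Q κ, starRingEnd ℂ (u y) * F (proj y) =
          ∫ y in Q κ, starRingEnd ℂ (u y - a) * F (proj y) := by
        have h1 : (fun y => starRingEnd ℂ (u y) * F (proj y)) =
            fun y => starRingEnd ℂ (u y - a) * F (proj y) + starRingEnd ℂ a * F (proj y) := by
          funext y; simp only [map_sub]; ring
        rw [h1, integral_add hi1 hi2, integral_const_mul]
        have h2 : ∫ y in Q κ, F (proj y) = 0 := by
          change ∫ y in Q κ, (f (proj y) : ℂ) = 0
          rw [integral_complex_ofReal, h0 κ, Complex.ofReal_zero]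
        rw [h2, mul_zero, add_zero]
      rw [hsplit]
      calc ‖∫ y in Q κ, starRingEnd ℂ (u y - a) * F (proj y)‖ₑ
          ≤ ∫⁻ y in Q κ, ‖starRingEnd ℂ (u y - a) * F (proj y)‖ₑ := enorm_integral_le_lintegral_enorm _
        _ = ∫⁻ y in Q κ, ((fun y => ‖u y - a‖ₑ) * fun y => ‖f (proj y)‖ₑ) y := by
            refine lintegral_congr fun y => ?_
            simp only [Pi.mul_apply, enorm_mul, RCLike.enorm_conj, hFdef]
            rw [← ofReal_norm (f (proj y) : ℂ), Complex.norm_real, ofReal_norm]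
        _ ≤ (∫⁻ y in Q κ, ‖u y - a‖ₑ ^ (2 : ℝ)) ^ (1 / (2 : ℝ)) *
              (∫⁻ y in Q κ, ‖f (proj y)‖ₑ ^ (2 : ℝ)) ^ (1 / (2 : ℝ)) :=
            ENNReal.lintegral_mul_le_Lp_mul_Lq _ Real.HolderConjugate.two_two
              (huc.sub continuous_const).measurable.enorm.aemeasurable
              (hf.comp continuous_proj).measurable.enorm.aemeasurable
        _ = A κ * B κ := by
            rw [hA, hB]
            dsimp only
            rw [eLpNorm_eq_lintegral_rpow_enorm_toReal (by norm_num) (by norm_num), ENNReal.toReal_ofNat]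
            congr 2
            exact congrArg (fun μ => ∫⁻ y, ‖u y - a‖ₑ ^ (2 : ℝ) ∂μ) (hrestr κ)
    have hpoinc : ∀ κ, A κ ≤ Cd * E κ := fun κ =>
      eLpNorm_sub_setAverage_latticeCell_le hm hu _
    -- `Σ_κ ‖Du‖²_{L²(Q_κ)} ≤ 4π² S`
    have hEsum : ∑ κ, E κ ^ (2 : ℝ) ≤ ENNReal.ofReal (4 * Real.pi ^ 2 * S) := by
      have hE2 : ∀ κ, E κ ^ (2 : ℝ) = ∫⁻ y in Q κ, ‖_root_.fderiv ℝ u y‖ₑ ^ (2 : ℝ) := by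
        intro κ
        rw [hE]
        dsimp only
        rw [eLpNorm_eq_lintegral_rpow_enorm_toReal (by norm_num) (by norm_num), ENNReal.toReal_ofNat,
          ← ENNReal.rpow_mul, one_div, inv_mul_cancel₀ (by norm_num : (2 : ℝ) ≠ 0),
          ENNReal.rpow_one]
        exact congrArg (fun μ => ∫⁻ y, ‖_root_.fderiv ℝ u y‖ₑ ^ (2 : ℝ) ∂μ) (hrestr κ).symm
      simp_rw [hE2]
      rw [← setLIntegral_unitCube_eq_sum_latticeCell hm]
      -- pointwise bound `‖Du y‖² ≤ Σⱼ ‖∂ⱼφ (proj y)‖²`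
      have hpt : ∀ y, ‖_root_.fderiv ℝ u y‖ₑ ^ (2 : ℝ) ≤
          ∑ j, ‖partialDeriv j φ (proj y)‖ₑ ^ (2 : ℝ) := by
        intro y
        have h1 : ‖_root_.fderiv ℝ u y‖ ≤ Real.sqrt (∑ j, ‖partialDeriv j φ (proj y)‖ ^ 2) := by
          rw [hudef, fderiv_lift]
          exact norm_fderiv_le_sqrt_sum_partialDeriv (hφ.isContDiff (n := 1) (by simp)) _
        have h2 : ‖_root_.fderiv ℝ u y‖ ^ 2 ≤ ∑ j, ‖partialDeriv j φ (proj y)‖ ^ 2 := by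
          calc ‖_root_.fderiv ℝ u y‖ ^ 2
              ≤ Real.sqrt (∑ j, ‖partialDeriv j φ (proj y)‖ ^ 2) ^ 2 :=
                pow_le_pow_left₀ (norm_nonneg _) h1 2
            _ = ∑ j, ‖partialDeriv j φ (proj y)‖ ^ 2 :=
                Real.sq_sqrt (Finset.sum_nonneg fun j _ => sq_nonneg _)
        calc ‖_root_.fderiv ℝ u y‖ₑ ^ (2 : ℝ) = ENNReal.ofReal (‖_root_.fderiv ℝ u y‖ ^ 2) := by
              rw [← ofReal_norm, ENNReal.rpow_two, ← ENNReal.ofReal_pow (norm_nonneg _)]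
          _ ≤ ENNReal.ofReal (∑ j, ‖partialDeriv j φ (proj y)‖ ^ 2) := ENNReal.ofReal_le_ofReal h2
          _ = ∑ j, ‖partialDeriv j φ (proj y)‖ₑ ^ (2 : ℝ) := by
              rw [ENNReal.ofReal_sum_of_nonneg fun j _ => sq_nonneg _]
              refine Finset.sum_congr rfl fun j _ => ?_
              rw [← ofReal_norm, ENNReal.rpow_two, ← ENNReal.ofReal_pow (norm_nonneg _)]
      calc ∫⁻ y in unitCube d, ‖_root_.fderiv ℝ u y‖ₑ ^ (2 : ℝ)
          ≤ ∫⁻ y in unitCube d, ∑ j, ‖partialDeriv j φ (proj y)‖ₑ ^ (2 : ℝ) :=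
            lintegral_mono fun y => hpt y
        _ = ∑ j, ∫⁻ y in unitCube d, ‖partialDeriv j φ (proj y)‖ₑ ^ (2 : ℝ) :=
            lintegral_finsetSum _ fun j _ =>
              ((hφ.partialDeriv j).continuous.comp continuous_proj).measurable.enorm.pow_const _
        _ = ∑ j, ∫⁻ x, ‖partialDeriv j φ x‖ₑ ^ (2 : ℝ) :=
            Finset.sum_congr rfl fun j _ => setLIntegral_unitCube_lift
              (H := fun x => ‖partialDeriv j φ x‖ₑ ^ (2 : ℝ))
              ((hφ.partialDeriv j).continuous.measurable.enorm.pow_const _).aemeasurable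
        _ = ∑ j, ENNReal.ofReal (∫ x, ‖partialDeriv j φ x‖ ^ 2) := by
            refine Finset.sum_congr rfl fun j _ => ?_
            rw [ofReal_integral_eq_lintegral_ofReal]
            · refine lintegral_congr fun x => ?_
              rw [← ofReal_norm, ENNReal.rpow_two, ← ENNReal.ofReal_pow (norm_nonneg _)]
            · exact ((hφ.partialDeriv j).continuous.norm.pow 2).integrable_unitAddTorus
            · exact ae_of_all _ fun x => sq_nonneg _
        _ = ENNReal.ofReal (∑ j, ∫ x, ‖partialDeriv j φ x‖ ^ 2) :=
            (ENNReal.ofReal_sum_of_nonneg fun j _ => integral_nonneg fun x => sq_nonneg _).symm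
        _ = ENNReal.ofReal (4 * Real.pi ^ 2 * S) := by rw [henergy]
    -- assemble: `S ≤ Cd · 2π · S^{1/2} · N`
    have hmain : ENNReal.ofReal S ≤ K * ENNReal.ofReal S ^ (1 / 2 : ℝ) := by
      have hlift : ∫ x, starRingEnd ℂ (φ x) * F x =
          ∑ κ, ∫ y in Q κ, starRingEnd ℂ (u y) * F (proj y) := by
        rw [integral_eq_integral_lift_holds (fun x => starRingEnd ℂ (φ x) * F x)]
        exact setIntegral_unitCube_eq_sum_latticeCell hm (integrableOn_unitCube_of_continuous
          ((Complex.continuous_conj.comp huc).mul (hF.comp continuous_proj)))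
      calc ENNReal.ofReal S = ‖∫ x, starRingEnd ℂ (φ x) * F x‖ₑ := by
            rw [hpair, ← ofReal_norm (S : ℂ), Complex.norm_real, ofReal_norm, Real.enorm_eq_ofReal hS0]
        _ = ‖∑ κ, ∫ y in Q κ, starRingEnd ℂ (u y) * F (proj y)‖ₑ := by rw [hlift]
        _ ≤ ∑ κ, ‖∫ y in Q κ, starRingEnd ℂ (u y) * F (proj y)‖ₑ := enorm_sum_le _ _
        _ ≤ ∑ κ, A κ * B κ := Finset.sum_le_sum fun κ _ => hcell κ
        _ ≤ ∑ κ, Cd * E κ * B κ := Finset.sum_le_sum fun κ _ => by gcongr; exact hpoinc κ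
        _ = Cd * ∑ κ, E κ * B κ := by rw [Finset.mul_sum]; simp_rw [mul_assoc]
        _ ≤ Cd * ((∑ κ, E κ ^ (2 : ℝ)) ^ (1 / (2 : ℝ)) * (∑ κ, B κ ^ (2 : ℝ)) ^ (1 / (2 : ℝ))) := by
            gcongr
            exact ENNReal.inner_le_Lp_mul_Lq _ _ _ Real.HolderConjugate.two_two
        _ ≤ Cd * ((ENNReal.ofReal (4 * Real.pi ^ 2 * S)) ^ (1 / (2 : ℝ)) * N) := by
            gcongr Cd * (?_ * ?_)
            · exact ENNReal.rpow_le_rpow hEsum (by norm_num)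
            · rw [hN]
              refine le_of_eq (congrArg (fun z => z ^ (1 / 2 : ℝ)) ?_)
              rw [← hBsum]
              refine Finset.sum_congr rfl fun κ _ => ?_
              rw [hB]
              dsimp only
              rw [← ENNReal.rpow_mul, one_div, inv_mul_cancel₀ (by norm_num : (2 : ℝ) ≠ 0),
                ENNReal.rpow_one]
        _ = K * ENNReal.ofReal S ^ (1 / 2 : ℝ) := by
            have h4 : ENNReal.ofReal (4 * Real.pi ^ 2 * S) =
                ENNReal.ofReal (2 * Real.pi) ^ (2 : ℝ) * ENNReal.ofReal S := by
              rw [ENNReal.rpow_two, ← ENNReal.ofReal_pow (by positivity), ← ENNReal.ofReal_mul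
                (by positivity)]
              ring_nf
            rw [h4, ENNReal.mul_rpow_of_nonneg _ _ (by norm_num : (0 : ℝ) ≤ 1 / 2),
              ← ENNReal.rpow_mul, show (2 : ℝ) * (1 / 2) = 1 by norm_num, ENNReal.rpow_one, hK]
            ring
    -- solve the quadratic inequality
    set X : ℝ≥0∞ := ENNReal.ofReal S ^ (1 / 2 : ℝ) with hX
    have hXsq : X ^ 2 = ENNReal.ofReal S := by
      rw [hX, ← ENNReal.rpow_natCast, ← ENNReal.rpow_mul]
      norm_num
    have hXtop : X ≠ ∞ := ENNReal.rpow_ne_top_of_nonneg (by norm_num) ENNReal.ofReal_ne_top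
    rcases eq_or_ne X 0 with hX0 | hX0
    · rw [← hXsq, hX0]; simp
    · have hXle : X ≤ K := by
        rw [← hXsq, sq] at hmain
        exact (ENNReal.mul_le_mul_iff_left hX0 hXtop).1 (by simpa [mul_comm] using hmain)
      rw [← hXsq]
      gcongr
  -- pass to the full series
  have htsum : ∑' k : d → ℤ, (if k = 0 then 0 else ENNReal.ofReal (freqNormSq k ^ (-1 : ℝ))) *
      ‖mFourierCoeff F k‖ₑ ^ 2 ≤ K ^ 2 := by
    rw [ENNReal.tsum_eq_iSup_sum]
    refine iSup_le fun T => ?_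
    refine le_trans (le_of_eq ?_) (key T)
    rw [ENNReal.ofReal_sum_of_nonneg fun k _ =>
      mul_nonneg (inv_nonneg.2 (freqNormSq_nonneg k)) (sq_nonneg _)]
    refine Finset.sum_congr rfl fun k _ => ?_
    split_ifs with hk
    · subst hk; simp
    · rw [Real.rpow_neg_one, ENNReal.ofReal_mul (inv_nonneg.2 (freqNormSq_nonneg k)),
        ← ofReal_norm, ← ENNReal.ofReal_pow (norm_nonneg _)]
  calc eHomSobolevSeminorm (-1) F
      = (∑' k : d → ℤ, (if k = 0 then 0 else ENNReal.ofReal (freqNormSq k ^ (-1 : ℝ))) *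
          ‖mFourierCoeff F k‖ₑ ^ 2) ^ (1 / 2 : ℝ) := rfl
    _ ≤ (K ^ 2) ^ (1 / 2 : ℝ) := ENNReal.rpow_le_rpow htsum (by norm_num)
    _ = K := by
        rw [← ENNReal.rpow_natCast, ← ENNReal.rpow_mul]; norm_num
    _ = _ := by
        rw [hK, hCd, mul_comm (ENNReal.ofReal (Real.sqrt _ / _)), mul_assoc, mul_assoc,
          ← mul_assoc (ENNReal.ofReal (Real.sqrt _ / _)), mul_comm (ENNReal.ofReal (Real.sqrt _ / _)),
          ← ENNReal.ofReal_mul (by positivity)]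
        ring

end HNegOne

end Torus

end Literature.Analysis.FunctionSpaces
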